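import Mathlib
import Summits.Ventures.PercRepro2.SevenKernel
import Summits.Ventures.PercRepro2.SevenConn
import Summits.Ventures.PercRepro2.SevenTables
import Summits.Ventures.PercRepro2.SevenTyped
import Summits.Ventures.PercRepro2.SevenHub2Certs01
import Summits.Ventures.PercRepro2.SevenHub2Certs02
import Summits.Ventures.PercRepro2.SevenHub2Certs03
import Summits.Ventures.PercRepro2.SevenHub2Certs04
import Summits.Ventures.PercRepro2.SevenHub2Certs05
import Summits.Ventures.PercRepro2.SevenHub2Certs06
import Summits.Ventures.PercRepro2.SevenHub2Certs07
import Summits.Ventures.PercRepro2.SevenHub2Certs08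
import Summits.Ventures.PercRepro2.SevenHub2Certs09
import Summits.Ventures.PercRepro2.SevenHub2Certs10
import Summits.Ventures.PercRepro2.SevenHub2Certs11
import Summits.Ventures.PercRepro2.SevenHub2Certs12
import Summits.Ventures.PercRepro2.SevenHub2Certs13
import Summits.Ventures.PercRepro2.SevenHub2Certs14
import Summits.Ventures.PercRepro2.SevenHub2Certs15
import Summits.Ventures.PercRepro2.SevenHub2Certs16
import Summits.Ventures.PercRepro2.SevenHub2Certs17
import Summits.Ventures.PercRepro2.SevenHub2Certs18
import Summits.Ventures.PercRepro2.SevenHub2Certs19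
import Summits.Ventures.PercRepro2.SevenHub2Certs20
import Summits.Ventures.PercRepro2.SevenHub2Certs21
import Summits.Ventures.PercRepro2.SevenHub2Certs22
import Summits.Ventures.PercRepro2.SevenHub2Certs23
import Summits.Ventures.PercRepro2.BlockSubstConn
import Summits.Ventures.PercRepro2.BlockSubstLaw

/-!
# THEOREM 33′ — (HCOV) AND ROW 2′TRI ON THE NON-ADJACENT TWO-HUB FAMILY
(blind cell PercRepro2, mine-2 g34)

`hub2 i j` (`i < j` in `Fin 10`): the unmarked vertices `u = 5`, `w = 6` joined to every mark, NOT adjacent, and the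
`i`-th and `j`-th of the ten pairs of marks (`mpair`, lexicographic order) as the two mark–mark edges — twelve edges.
A seven-vertex graph whose two unmarked vertices are joined to any of the marks (not to each other) while the marks span
AT MOST TWO edges is one of the 45 skeletons with some edges at weight `0`; with THEOREM 33 (`SevenHub.lean`, hubs
adjacent and at most one mark–mark edge) this is the two-hub family of the cell: genuinely seven-terminal instances of
S4's boundary (the adjacent / non-adjacent unmarked pair attached to up to five marks), (HCOV) and row 2′TRI for every
weight vector.  The 45 certificates `cert_hub2_01 … cert_hub2_89` are `SevenHub2Certs01–23.lean`; `HCov_of_hub2` lifts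
each skeleton to its block substitutions (`BlockSubst.HCov_of_skeleton`).  Own work; standard axioms.
-/

namespace Summit.Ventures.PercRepro2

namespace Seven

/-- The ten pairs of marks in lexicographic order. -/
def mpair : Fin 10 → Fin 7 × Fin 7 := ![(0, 1), (0, 2), (0, 3), (0, 4), (1, 2), (1, 3), (1, 4), (2, 3), (2, 4), (3, 4)]

/-- **The non-adjacent two-hub skeleton with the mark–mark edges `mpair i`, `mpair j`**. -/
def hub2 (i j : Fin 10) : Fin 12 → Fin 7 × Fin 7 :=
  ![(0, 5), (1, 5), (2, 5), (3, 5), (4, 5), (0, 6), (1, 6), (2, 6), (3, 6), (4, 6), mpair i, mpair j]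

set_option maxRecDepth 100000 in
/-- **Every pair of mark–mark edges has its certificate**: `Cert (hub2 i j)` for all `i < j` in `Fin 10`. -/
theorem cert2_all (i j : Fin 10) (hij : i < j) : Cert (hub2 i j) := by
  fin_cases i <;> fin_cases j
  · exact absurd hij (by decide)
  · exact cert_hub2_01
  · exact cert_hub2_02
  · exact cert_hub2_03
  · exact cert_hub2_04
  · exact cert_hub2_05
  · exact cert_hub2_06
  · exact cert_hub2_07
  · exact cert_hub2_08
  · exact cert_hub2_09
  · exact absurd hij (by decide)
  · exact absurd hij (by decide)
  · exact cert_hub2_12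
  · exact cert_hub2_13
  · exact cert_hub2_14
  · exact cert_hub2_15
  · exact cert_hub2_16
  · exact cert_hub2_17
  · exact cert_hub2_18
  · exact cert_hub2_19
  · exact absurd hij (by decide)
  · exact absurd hij (by decide)
  · exact absurd hij (by decide)
  · exact cert_hub2_23
  · exact cert_hub2_24
  · exact cert_hub2_25
  · exact cert_hub2_26
  · exact cert_hub2_27
  · exact cert_hub2_28
  · exact cert_hub2_29
  · exact absurd hij (by decide)
  · exact absurd hij (by decide)
  · exact absurd hij (by decide)
  · exact absurd hij (by decide)
  · exact cert_hub2_34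
  · exact cert_hub2_35
  · exact cert_hub2_36
  · exact cert_hub2_37
  · exact cert_hub2_38
  · exact cert_hub2_39
  · exact absurd hij (by decide)
  · exact absurd hij (by decide)
  · exact absurd hij (by decide)
  · exact absurd hij (by decide)
  · exact absurd hij (by decide)
  · exact cert_hub2_45
  · exact cert_hub2_46
  · exact cert_hub2_47
  · exact cert_hub2_48
  · exact cert_hub2_49
  · exact absurd hij (by decide)
  · exact absurd hij (by decide)
  · exact absurd hij (by decide)
  · exact absurd hij (by decide)
  · exact absurd hij (by decide)
  · exact absurd hij (by decide)
  · exact cert_hub2_56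
  · exact cert_hub2_57
  · exact cert_hub2_58
  · exact cert_hub2_59
  · exact absurd hij (by decide)
  · exact absurd hij (by decide)
  · exact absurd hij (by decide)
  · exact absurd hij (by decide)
  · exact absurd hij (by decide)
  · exact absurd hij (by decide)
  · exact absurd hij (by decide)
  · exact cert_hub2_67
  · exact cert_hub2_68
  · exact cert_hub2_69
  · exact absurd hij (by decide)
  · exact absurd hij (by decide)
  · exact absurd hij (by decide)
  · exact absurd hij (by decide)
  · exact absurd hij (by decide)
  · exact absurd hij (by decide)
  · exact absurd hij (by decide)
  · exact absurd hij (by decide)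
  · exact cert_hub2_78
  · exact cert_hub2_79
  · exact absurd hij (by decide)
  · exact absurd hij (by decide)
  · exact absurd hij (by decide)
  · exact absurd hij (by decide)
  · exact absurd hij (by decide)
  · exact absurd hij (by decide)
  · exact absurd hij (by decide)
  · exact absurd hij (by decide)
  · exact absurd hij (by decide)
  · exact cert_hub2_89
  · exact absurd hij (by decide)
  · exact absurd hij (by decide)
  · exact absurd hij (by decide)
  · exact absurd hij (by decide)
  · exact absurd hij (by decide)
  · exact absurd hij (by decide)
  · exact absurd hij (by decide)
  · exact absurd hij (by decide)
  · exact absurd hij (by decide)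
  · exact absurd hij (by decide)

section Theorem

variable {R : Type*} [Field R] [LinearOrder R] [IsStrictOrderedRing R]

/-- **THEOREM 33′ (typed form): row 2′TRI on every non-adjacent two-hub skeleton `hub2 i j`, `i < j`.** -/
theorem typedBases_hub2 (i j : Fin 10) (hij : i < j) :
    CovForm.TypedBases (R := R) (ends (hub2 i j)) 0 1 2 3 4 :=
  typedBases (hub2 i j) (cert2_all i j hij)

/-- **THEOREM 33′: (HCOV) on every non-adjacent two-hub skeleton `hub2 i j`, `i < j`, for every weight vector** —
every seven-vertex graph whose two unmarked vertices are joined to any of the five marks but not to each other while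
the marks span at most the two edges `mpair i`, `mpair j`, the twelve edges at any weights. -/
theorem HCov_hub2 (i j : Fin 10) (hij : i < j) (p : Fin 12 → R) (hp : IsProbVec p) :
    CovForm.HCov p (ends (hub2 i j)) 0 1 2 3 4 :=
  HCov_seven (hub2 i j) (cert2_all i j hij) p hp

/-- **THEOREM 33′ lifted by block substitution**: (HCOV) on every graph whose edges fall into mark-free two-terminal
blocks on a skeleton `hub2 i j` (`i < j`) along an injective terminal map `q : Fin 7 → V`. -/
theorem HCov_of_hub2 {V E : Type*} [Fintype E] [DecidableEq E] [DecidableEq V] {ends : E → Sym2 V}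
    {q : Fin 7 → V} {blk : E → Fin 12} {Vj : Fin 12 → Set V} {i j : Fin 10} (hij : i < j)
    (hB : BlockSubst.IsBlockSubst ends (Seven.ends (hub2 i j)) q blk Vj) (p : E → R) (hp : IsProbVec p) :
    CovForm.HCov p ends (q 0) (q 1) (q 2) (q 3) (q 4) :=
  BlockSubst.HCov_of_skeleton hB 0 1 2 3 4 (fun r hr => HCov_hub2 i j hij r hr) p hp

end Theorem

end Seven

end Summit.Ventures.PercRepro2
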